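import Summits.Ventures.QEC.Theorems.BB144DistanceCertificateNoZLogicalBelowTwelve
import Summits.Ventures.QEC.Theorems.BB144DistanceCertificateTwelveLogicalQubits144
import HarnessLib

/-!
# Route BB144DistanceCertificate, item Target (stmt-Ventures-19771): the gross code `QC(x³+y+y², y³+x+x²)` on
# `ℤ₁₂ × ℤ₆` has parameters `[[144, 12, 12]]` — the printed CLAIM of Bravyi et al. 2024 Table 1 (grant milestone
# «certified distance computations»), as a theorem: `Summit.Ventures.QEC.BB.BB144_12_12_claim`

The route's deciding glue `closes` applied to the three closed items: `noZLogicalBelowTwelve_proof` (qec-type-10 on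
qec-search-7's `bz_aut` block verdicts, type-12's orbit cover, type-07's Brouwer–Zimmermann propositions),
`weightTwelveZLogical_proof` (qec-type-10, the certificate's weight-12 witness) and `TwelveLogicalQubits144_proof`
(qec-type-02, rank certificates `r_X = r_Z = 66`). TIER: KERNEL-std — axioms ⊆ {propext, Classical.choice,
Quot.sound} for every declaration since the revision of `Theorems/BB144DistanceCertificateNoZLogicalBelowTwelve.lean`
(p487807, 2026-08-27: lane-parallel KERNEL enumeration verdicts + type-12's tabulated kernel cover; before it the tier
was CHECKED-native through `native_decide` verdicts). This file's text is unchanged except this note (re-filed to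
re-record the axiom closure; statements byte-identical). Consequences recorded: `d_Z = d_X = d = 12` for `BB.bb144`.
-/

namespace Summit.Ventures.QEC.Census.BB144

open Literature.InformationTheory.QuantumCodes Summit.Ventures.QEC.BB
  Summit.Ventures.QEC.Theses.BB144DistanceCertificate

/-- **Item Target, PROVED — `[[144, 12, 12]]`**: `HasParams BB.bb144 144 12 12`. -/
theorem target144_proof : Summit.Ventures.QEC.Theses.BB144DistanceCertificate.Target :=
  closes noZLogicalBelowTwelve_proof weightTwelveZLogical_proof
    Summit.Ventures.QEC.Theorems.TwelveLogicalQubits144_proof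

/-- **The registered CLAIM leaf discharged**: `Summit.Ventures.QEC.BB.BB144_12_12_claim`. -/
theorem BB144_12_12_claim_holds : Summit.Ventures.QEC.BB.BB144_12_12_claim := target144_proof

/-- `d_Z(BB.bb144) = 12`. -/
theorem bb144_dZ : BB.bb144.css.dZ = 12 := (dX_eq_of_hasParams BB144_12_12_claim_holds).2

/-- `d_X(BB.bb144) = 12` (`d_X = d = d_Z`, Lemma 1). -/
theorem bb144_dX : BB.bb144.css.dX = 12 := (dX_eq_of_hasParams BB144_12_12_claim_holds).1

/-- `d(BB.bb144) = 12`. -/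
theorem bb144_d : BB.bb144.d = 12 := BB144_12_12_claim_holds.2.2

end Summit.Ventures.QEC.Census.BB144
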